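import Summits.CriticalPhenomena.PercolationContinuityZ3.Theorems.PercNearOneGluingNoHeavyLowerTailMajorityGluingQCertVec
import Summits.CriticalPhenomena.PercolationContinuityZ3.Theorems.PercNearOneGluingNoHeavyLowerTailMajorityGluingQCertSixFourA
import Summits.CriticalPhenomena.PercolationContinuityZ3.Theorems.PercNearOneGluingNoHeavyLowerTailMajorityGluingQCertSixFourB
import HarnessLib

/-!
# The `(6,4)` certificate with constant `63/50` PASSES the kernel check (lane prim-rate, constants-miner 1, gen 34; CANDIDATES §GEN-33 R324, NEXT-g34 item 1)

Support file for the closed crux `NoHeavyLowerTail` (stmt-CriticalPhenomena-4575), majority-gluing line.  `sixFour` assembles the certificate of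
`…QCertSixFourA/B` (`m = 6`, `h = 4`, `cN/cD = 63/50`, case family `1` = «`E_x = μ(relay x attached, ≥ 4 of the six cut)`»); the structural
check `checkW` (denominator, threshold, `ℓ_D > 0`, indices in range, the `4·276` cylinder masks) and the quadratic check `checkQ` on the
`65` variable rows (in three chunks, `checkQ_append`) are evaluated by `decide +kernel` — exact integer arithmetic in the kernel, no
`native_decide`, standard axioms; `set_option maxHeartbeats 0` only lifts the elaborator's budget for these closed evaluations (≈ 10–20 s each).
Consequence (`…QCertSound`, `Cert.sound`): at every nonnegative point satisfying the marginal, case-chain and van den Berg–Kahn row hypotheses,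
`50·T ≤ 63·x_D`; the percolation reading (`μ(≥ 4 of 6 relays cut) ≤ (63/50)·max marginal`) is `…MajorityGluingEightCert`.  No sorries.
-/

namespace Summit.CriticalPhenomena.PercolationContinuityZ3.Theorems

namespace HubOnly
namespace QCert

/-- **The `(6,4)` certificate for the constant `63/50`** (mine-1 gen 33, kit j266227; integer translation gen 34). -/
def sixFour : Cert := ⟨6, 4, 63, 50, 1, sixFourLin, sixFourRows, sixFourSqs⟩

set_option maxHeartbeats 0 in
/-- The structural check passes. -/
theorem sixFour_checkW : sixFour.checkW = true := by decide +kernel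

set_option maxHeartbeats 0 in
/-- The quadratic check passes on the variable rows `[0, 22)`. -/
theorem sixFour_checkQ_0 : sixFour.checkQ 0 22 = true := by decide +kernel

set_option maxHeartbeats 0 in
/-- The quadratic check passes on the variable rows `[22, 44)`. -/
theorem sixFour_checkQ_22 : sixFour.checkQ 22 44 = true := by decide +kernel

set_option maxHeartbeats 0 in
/-- The quadratic check passes on the variable rows `[44, 65)`. -/
theorem sixFour_checkQ_44 : sixFour.checkQ 44 65 = true := by decide +kernel

/-- The quadratic check passes on all `65` variable rows. -/
theorem sixFour_checkQ : sixFour.checkQ 0 sixFour.NV = true :=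
  sixFour.checkQ_append (sixFour.checkQ_append sixFour_checkQ_0 sixFour_checkQ_22) sixFour_checkQ_44

/-- **THE `63/50` CERTIFICATE PASSES.** -/
theorem sixFour_check : sixFour.check = true := by
  rw [Cert.check, sixFour_checkW, sixFour_checkQ, Bool.true_and]

end QCert
end HubOnly

end Summit.CriticalPhenomena.PercolationContinuityZ3.Theorems
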